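import Literature.Barriers.AtomisticToContinuum.HardDiskTranslationInvarianceSteps
import Literature.Analysis.FunctionSpaces.PointConfigKernel
import Literature.Analysis.FunctionSpaces.PoissonMeckePrelims
import Mathlib.MeasureTheory.Measure.Prod
import Mathlib.MeasureTheory.Group.Arithmetic
import HarnessLib

/-!
# Hard-disc Gibbs kernels: measurability (Richthammer 2007, §3.2–3.3 and §3.6)

Infrastructure for the bottom-up proof of Richthammer's estimate (3.5)
(`Richthammer2007_ineq35`, file `HardDiskTranslationInvarianceSteps.lean`). The DLR equation of
`IsGibbs z μ` reads `μ A = ∫⁻ Y, γ_Λ(A | Y) ∂μ`; every manipulation of it (splitting a sum of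
two events, monotone convergence, Fubini) needs the boundary condition `Y ↦ γ_Λ(A | Y)` to be
measurable, which Richthammer settles once and for all by the list of measurability-preserving
operations of §3.6 (Lemma 6) and "the measurability part of Fubini's theorem". This file proves
exactly that for the objects of `HardDiskTranslationInvariance.lean` (all in the plane
`ℝ² = EuclideanSpace ℝ (Fin 2)`):

* `measurableSet_hardCoreIn` — the event `{X | e^{-H_Λ(X)} = 1}` of configurations satisfying
  the hard core in `Λ` is measurable (via the Campbell sum `∑_{p ∈ X} 1_Λ(p) 1{N_{B(p,1)}(X) ≥ 2}`
  of occupation events, [Richthammer2007, §4.4 proof of Lemma 6]); so is `{X | IsHardCore X}`;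
* `measurable_ofFn` — `x ↦ {x₁, …, x_k}` is measurable on `(ℝ²)^k`;
* `superpose_eq_union`, `count_superpose`, `measurable_superpose` — the superposition
  `(x, Y) ↦ ({x_i} ∩ Λ) ∪ (Y ∩ Λᶜ)` is jointly measurable (its counting variables split as
  `N_{Λ ∩ s}({x_i}) + N_{Λᶜ ∩ s}(Y)`, [Richthammer2007, §4.4]);
* `hardCoreIn_superpose_iff` — the hard-core constraint in coordinates;
* `measurable_weight`, `measurable_gibbsKernel` — `Y ↦ weight z Λ Y A` and
  `Y ↦ γ_Λ(A | Y) = gibbsKernel z Λ Y A` are measurable for measurable `Λ`, `A`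
  ("`γ_Λ` is a probability kernel from `(𝒳𝒳, 𝓕_{𝒳𝒳,Λᶜ})` to `(𝒳, 𝓕_𝒳)`",
  [Richthammer2007, §3.3 p. 7]).

## References

* [Richthammer2007] T. Richthammer, *Translation-invariance of two-dimensional Gibbsian point
  processes*, Comm. Math. Phys. 274 (2007) 81–122, arXiv:0706.3637: §3.2–3.3 (pp. 6–7), §3.6
  Lemma 6 (p. 8), §4.4 (p. 9).
* [Richthammer2016] T. Richthammer, *Lower bound on the mean square displacement of particles in
  the hard disk model*, Comm. Math. Phys. 345 (2016), §2 (the set `𝒳𝒳` of hard-disc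
  configurations).
-/

noncomputable section

open MeasureTheory Set
open scoped ENNReal

namespace Literature.Barriers.AtomisticToContinuum.HardDisk

open Literature.Analysis.FunctionSpaces

/-! ### The hard-core event of configurations is measurable -/

/-- Negation of the hard-core constraint in `Λ`: some point of `X` in `Λ` has another point of
`X` within distance `1`. [cite: Richthammer2007, §3.3 (3.2)] -/
theorem not_hardCoreIn_iff (Λ : Set (EuclideanSpace ℝ (Fin 2)))
    (X : PointConfig (EuclideanSpace ℝ (Fin 2))) :
    ¬ HardCoreIn Λ X ↔ ∃ p ∈ X, p ∈ Λ ∧ ∃ q ∈ X, q ≠ p ∧ dist p q ≤ 1 := by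
  constructor
  · intro h
    simp only [HardCoreIn, not_forall, not_lt, exists_prop] at h
    obtain ⟨p, hp, q, hq, hpq, hΛ, hd⟩ := h
    rcases hΛ with hpΛ | hqΛ
    · exact ⟨p, hp, hpΛ, q, hq, Ne.symm hpq, hd⟩
    · exact ⟨q, hq, hqΛ, p, hp, hpq, by rwa [dist_comm]⟩
  · rintro ⟨p, hp, hpΛ, q, hq, hqp, hd⟩ h
    exact absurd (h p hp q hq (Ne.symm hqp) (Or.inl hpΛ)) (not_lt.2 hd)

/-- `N_s(X) ≥ 2` iff `X` has two distinct points in `s`. [folklore] -/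
theorem two_le_count_iff (X : PointConfig (EuclideanSpace ℝ (Fin 2)))
    (s : Set (EuclideanSpace ℝ (Fin 2))) :
    2 ≤ X.count s ↔ ∃ a ∈ X, ∃ b ∈ X, a ∈ s ∧ b ∈ s ∧ a ≠ b := by
  rw [PointConfig.count, ← (one_add_one_eq_two : (1 : ℕ∞) + 1 = 2),
    ENat.add_one_le_iff ENat.one_ne_top, Set.one_lt_encard_iff]
  simp only [mem_inter_iff, PointConfig.mem_carrier]
  constructor
  · rintro ⟨a, b, ⟨ha, has⟩, ⟨hb, hbs⟩, hab⟩
    exact ⟨a, ha, b, hb, has, hbs, hab⟩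
  · rintro ⟨a, ha, b, hb, has, hbs, hab⟩
    exact ⟨a, b, ⟨ha, has⟩, ⟨hb, hbs⟩, hab⟩

/-- **The hard-core event `{X | e^{-H_Λ(X)} = 1}` is measurable** for measurable `Λ`: its
complement is `{X | ∑_{p ∈ X} 1_Λ(p) 1{N_{B(p,1)}(X) ≥ 2} ≠ 0}`, a Campbell sum of
occupation events. [cite: Richthammer2007, §3.6 Lemma 6 and §4.4 (p. 9)] -/
theorem measurableSet_hardCoreIn {Λ : Set (EuclideanSpace ℝ (Fin 2))} (hΛ : MeasurableSet Λ) :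
    MeasurableSet {X : PointConfig (EuclideanSpace ℝ (Fin 2)) | HardCoreIn Λ X} := by
  -- the occupation numbers `N_{B(p,1)}(X)` are jointly measurable in `(X, p)`
  set B : Set ((PointConfig (EuclideanSpace ℝ (Fin 2)) × EuclideanSpace ℝ (Fin 2)) ×
      EuclideanSpace ℝ (Fin 2)) := {r | dist r.1.2 r.2 ≤ 1} with hB
  have hball : MeasurableSet B :=
    measurableSet_le ((measurable_snd.comp measurable_fst).dist measurable_snd) measurable_const
  have hF : Measurable fun a : PointConfig (EuclideanSpace ℝ (Fin 2)) × EuclideanSpace ℝ (Fin 2) =>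
      a.1.toMeasure (Prod.mk a ⁻¹' B) :=
    PointConfig.measurable_toMeasure_preimage hball measurable_fst
  set S : Set (PointConfig (EuclideanSpace ℝ (Fin 2)) × EuclideanSpace ℝ (Fin 2)) :=
    {a | a.2 ∈ Λ ∧ 2 ≤ a.1.toMeasure (Prod.mk a ⁻¹' B)} with hS
  have hSm : MeasurableSet S :=
    (hΛ.preimage measurable_snd).inter (measurableSet_le measurable_const hF)
  have hT : Measurable fun X : PointConfig (EuclideanSpace ℝ (Fin 2)) =>
      ∑' p : ((X : PointConfig (EuclideanSpace ℝ (Fin 2))) : Set (EuclideanSpace ℝ (Fin 2))),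
        S.indicator 1 (X, (p : EuclideanSpace ℝ (Fin 2))) :=
    PointConfig.measurable_tsum_carrier (measurable_one.indicator hSm) measurable_id
  have hcount : ∀ (X : PointConfig (EuclideanSpace ℝ (Fin 2))) (p : EuclideanSpace ℝ (Fin 2)),
      X.toMeasure (Prod.mk (X, p) ⁻¹' B) = X.count {q | dist p q ≤ 1} := fun X p => by
    rw [PointConfig.toMeasure_apply _ (measurable_prodMk_left hball)]
    rfl
  -- membership in `S` means: `p ∈ Λ` and some other point of `X` is within distance `1` of `p`
  have hmemS : ∀ (X : PointConfig (EuclideanSpace ℝ (Fin 2))) (p : EuclideanSpace ℝ (Fin 2)),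
      p ∈ X → ((X, p) ∈ S ↔ p ∈ Λ ∧ ∃ q ∈ X, q ≠ p ∧ dist p q ≤ 1) := fun X p hp => by
    rw [hS, mem_setOf_eq, hcount]
    refine and_congr Iff.rfl ?_
    have hcast : (2 : ℝ≥0∞) ≤ (X.count {q | dist p q ≤ 1} : ℝ≥0∞) ↔
        2 ≤ X.count {q | dist p q ≤ 1} := by norm_cast
    rw [hcast, two_le_count_iff]
    constructor
    · rintro ⟨a, ha, b, hb, had, hbd, hab⟩
      simp only [mem_setOf_eq] at had hbd
      by_cases hap : a = p
      · subst hap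
        exact ⟨b, hb, Ne.symm hab, hbd⟩
      · exact ⟨a, ha, hap, had⟩
    · rintro ⟨q, hq, hqp, hd⟩
      exact ⟨p, hp, q, hq, by simp, hd, hqp.symm⟩
  -- identification of the event
  have key : {X : PointConfig (EuclideanSpace ℝ (Fin 2)) | HardCoreIn Λ X} =
      {X | ∑' p : ((X : PointConfig (EuclideanSpace ℝ (Fin 2))) : Set (EuclideanSpace ℝ (Fin 2))),
        S.indicator (1 : PointConfig (EuclideanSpace ℝ (Fin 2)) × EuclideanSpace ℝ (Fin 2) → ℝ≥0∞)
          (X, (p : EuclideanSpace ℝ (Fin 2))) = 0} := by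
    ext X
    simp only [mem_setOf_eq, ENNReal.tsum_eq_zero, Set.indicator_apply_eq_zero, Pi.one_apply,
      one_ne_zero, imp_false, Subtype.forall]
    rw [← not_iff_not, not_hardCoreIn_iff]
    push Not
    constructor
    · rintro ⟨p, hp, hpΛ, q, hq, hqp, hd⟩
      exact ⟨p, hp, (hmemS X p hp).2 ⟨hpΛ, q, hq, hqp, hd⟩⟩
    · rintro ⟨p, hp, hpS⟩
      obtain ⟨hpΛ, q, hq, hqp, hd⟩ := (hmemS X p hp).1 hpS
      exact ⟨p, hp, hpΛ, q, hq, hqp, hd⟩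
  rw [key]
  exact hT (measurableSet_singleton 0)

/-- The global hard-core event `𝒳𝒳` (all pairs at distance `> 1`) is measurable: it is the
intersection of the events for `Λ = Λ_m`, `m ∈ ℕ`. [cite: Richthammer2016, §2 (p. 4)] -/
theorem measurableSet_isHardCore :
    MeasurableSet {X : PointConfig (EuclideanSpace ℝ (Fin 2)) | IsHardCore X} := by
  have : {X : PointConfig (EuclideanSpace ℝ (Fin 2)) | IsHardCore X} =
      ⋂ m : ℕ, {X | HardCoreIn (box m) X} := by
    ext X
    simp only [mem_setOf_eq, mem_iInter]
    constructor
    · exact fun h m => h.hardCoreIn _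
    · intro h p hp q hq hpq
      obtain ⟨m, hm⟩ := exists_mem_box p
      exact h m p hp q hq hpq (Or.inl hm)
  rw [this]
  exact MeasurableSet.iInter fun m => measurableSet_hardCoreIn (measurableSet_box m)

/-! ### Finite configurations and superpositions are measurable -/

/-- Nothing belongs to the empty configuration. [folklore] -/
theorem not_mem_empty (y : EuclideanSpace ℝ (Fin 2)) :
    y ∉ (∅ : PointConfig (EuclideanSpace ℝ (Fin 2))) := fun h => by
  have h' : y ∈ (∅ : PointConfig (EuclideanSpace ℝ (Fin 2))).carrier := h
  simp at h'

/-- The finite configuration `{x₁, …, x_k}` depends measurably on `x ∈ (ℝ²)^k` (count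
σ-algebra on configurations). [cite: Richthammer2007, §3.6 Lemma 6 (3.6)] -/
theorem measurable_ofFn (k : ℕ) :
    Measurable fun x : Fin k → EuclideanSpace ℝ (Fin 2) => PointConfig.ofFn x := by
  have h := (PointConfig.measurable_union_ofFn (E := EuclideanSpace ℝ (Fin 2)) k).comp
    (measurable_id.prodMk
      (measurable_const (a := (∅ : PointConfig (EuclideanSpace ℝ (Fin 2))))))
  convert h using 1
  funext x
  ext y
  simp only [Function.comp_apply, id_eq, PointConfig.mem_union]
  exact ⟨fun hy => Or.inr hy, fun hy => hy.elim (fun h => (not_mem_empty y h).elim) id⟩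

/-- The superposition is the union of the thrown points restricted to `Λ` and of the boundary
condition restricted to `Λᶜ`: `X_Λ X̄_{Λᶜ}`. [cite: Richthammer2007, §3.2 (p. 6)] -/
theorem superpose_eq_union (Λ : Set (EuclideanSpace ℝ (Fin 2))) {k : ℕ}
    (x : Fin k → EuclideanSpace ℝ (Fin 2)) (Y : PointConfig (EuclideanSpace ℝ (Fin 2))) :
    superpose Λ x Y = (PointConfig.ofFn x).restrict Λ ∪ Y.restrict Λᶜ := by
  ext y
  simp only [mem_superpose, PointConfig.mem_union]
  rfl

/-- Counting variables of a superposition: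
`N_s(X_Λ X̄_{Λᶜ}) = N_{Λ ∩ s}({x_i}) + N_{Λᶜ ∩ s}(X̄)`. [cite: Richthammer2007, §4.4 (p. 9)] -/
theorem count_superpose (Λ : Set (EuclideanSpace ℝ (Fin 2))) {k : ℕ}
    (x : Fin k → EuclideanSpace ℝ (Fin 2)) (Y : PointConfig (EuclideanSpace ℝ (Fin 2)))
    (s : Set (EuclideanSpace ℝ (Fin 2))) :
    (superpose Λ x Y).count s = (PointConfig.ofFn x).count (Λ ∩ s) + Y.count (Λᶜ ∩ s) := by
  simp only [PointConfig.count]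
  have h1 : (superpose Λ x Y).carrier ∩ s =
      ((PointConfig.ofFn x).carrier ∩ (Λ ∩ s)) ∪ (Y.carrier ∩ (Λᶜ ∩ s)) := by
    ext y
    simp only [mem_inter_iff, mem_union, PointConfig.carrier_ofFn, mem_compl_iff]
    change ((y ∈ Set.range x ∧ y ∈ Λ) ∨ (y ∈ (Y : Set (EuclideanSpace ℝ (Fin 2))) ∧ y ∉ Λ)) ∧
      y ∈ s ↔ _
    simp only [PointConfig.coe_eq_carrier]
    tauto
  rw [h1, Set.encard_union_eq]
  exact Set.disjoint_left.2 fun y hy hy' => hy'.2.1 hy.2.1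

/-- **Joint measurability of the superposition** `(x, X̄) ↦ X_Λ X̄_{Λᶜ}`, `X = {x_i}`, for
measurable `Λ`. [cite: Richthammer2007, §3.6 Lemma 6 and §4.4] -/
theorem measurable_superpose {Λ : Set (EuclideanSpace ℝ (Fin 2))} (hΛ : MeasurableSet Λ)
    (k : ℕ) :
    Measurable fun p : (Fin k → EuclideanSpace ℝ (Fin 2)) ×
      PointConfig (EuclideanSpace ℝ (Fin 2)) => superpose Λ p.1 p.2 := by
  refine PointConfig.measurable_of_count fun s hs => ?_
  simp_rw [count_superpose]
  have h1 : Measurable fun p : (Fin k → EuclideanSpace ℝ (Fin 2)) ×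
      PointConfig (EuclideanSpace ℝ (Fin 2)) => (PointConfig.ofFn p.1).count (Λ ∩ s) :=
    (PointConfig.measurable_count (hΛ.inter hs)).comp ((measurable_ofFn k).comp measurable_fst)
  have h2 : Measurable fun p : (Fin k → EuclideanSpace ℝ (Fin 2)) ×
      PointConfig (EuclideanSpace ℝ (Fin 2)) => p.2.count (Λᶜ ∩ s) :=
    (PointConfig.measurable_count (hΛ.compl.inter hs)).comp measurable_snd
  exact (measurable_of_countable fun q : ℕ∞ × ℕ∞ => q.1 + q.2).comp (h1.prodMk h2)

/-- For a fixed boundary condition, `x ↦ X_Λ X̄_{Λᶜ}` is measurable.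
[cite: Richthammer2007, §3.6] -/
theorem measurable_superpose_left {Λ : Set (EuclideanSpace ℝ (Fin 2))} (hΛ : MeasurableSet Λ)
    (k : ℕ) (Y : PointConfig (EuclideanSpace ℝ (Fin 2))) :
    Measurable fun x : Fin k → EuclideanSpace ℝ (Fin 2) => superpose Λ x Y :=
  (measurable_superpose hΛ k).comp (measurable_id.prodMk measurable_const)

/-! ### The hard-core constraint on a superposition -/

/-- The hard-core constraint in `Λ` on a superposition, in coordinates: thrown points in `Λ`
are mutually at distance `> 1` (or coincide), and each of them is at distance `> 1` from every
point of the boundary condition outside `Λ`. [cite: Richthammer2007, §3.3 (p. 7)] -/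
theorem hardCoreIn_superpose_iff (Λ : Set (EuclideanSpace ℝ (Fin 2))) {k : ℕ}
    (x : Fin k → EuclideanSpace ℝ (Fin 2)) (Y : PointConfig (EuclideanSpace ℝ (Fin 2))) :
    HardCoreIn Λ (superpose Λ x Y) ↔
      (∀ i j, x i ∈ Λ → x j ∈ Λ → x i ≠ x j → 1 < dist (x i) (x j)) ∧
        (∀ i, x i ∈ Λ → ∀ q ∈ Y, q ∉ Λ → 1 < dist (x i) q) := by
  constructor
  · intro h
    refine ⟨fun i j hi hj hij =>
        h _ (Or.inl ⟨⟨i, rfl⟩, hi⟩) _ (Or.inl ⟨⟨j, rfl⟩, hj⟩) hij (Or.inl hi),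
      fun i hi q hq hqΛ => h _ (Or.inl ⟨⟨i, rfl⟩, hi⟩) _ (Or.inr ⟨hq, hqΛ⟩) ?_ (Or.inl hi)⟩
    rintro rfl
    exact hqΛ hi
  · rintro ⟨h1, h2⟩ p hp q hq hpq hΛ
    rcases hp with ⟨⟨i, rfl⟩, hi⟩ | ⟨hpY, hpΛ⟩ <;>
      rcases hq with ⟨⟨j, rfl⟩, hj⟩ | ⟨hqY, hqΛ⟩
    · exact h1 i j hi hj hpq
    · exact h2 i hi _ hqY hqΛ
    · rw [dist_comm]; exact h2 j hj _ hpY hpΛ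
    · exact (hΛ.elim hpΛ hqΛ).elim

/-- The hard-core event is jointly measurable in the thrown points and the boundary condition.
[cite: Richthammer2007, §3.6 Lemma 6 and §4.4] -/
theorem measurableSet_hardCoreIn_superpose {Λ : Set (EuclideanSpace ℝ (Fin 2))}
    (hΛ : MeasurableSet Λ) (k : ℕ) :
    MeasurableSet {p : (Fin k → EuclideanSpace ℝ (Fin 2)) ×
      PointConfig (EuclideanSpace ℝ (Fin 2)) | HardCoreIn Λ (superpose Λ p.1 p.2)} :=
  (measurableSet_hardCoreIn hΛ).preimage (measurable_superpose hΛ k)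

/-- For a fixed boundary condition, the hard-core event is measurable in the thrown points.
[cite: Richthammer2007, §3.6] -/
theorem measurableSet_hardCoreIn_superpose_left {Λ : Set (EuclideanSpace ℝ (Fin 2))}
    (hΛ : MeasurableSet Λ) (k : ℕ) (Y : PointConfig (EuclideanSpace ℝ (Fin 2))) :
    MeasurableSet {x : Fin k → EuclideanSpace ℝ (Fin 2) | HardCoreIn Λ (superpose Λ x Y)} :=
  (measurableSet_hardCoreIn hΛ).preimage (measurable_superpose_left hΛ k Y)

/-! ### Measurability of the finite-volume weights and of the Gibbs kernel -/

/-- The integrand of `weight z Λ Y A`, `1_{A ∩ {hard core in Λ}}(X_Λ X̄_{Λᶜ})`, is jointly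
measurable in `(x, X̄)` for measurable `Λ`, `A`. [cite: Richthammer2007, §3.6 and §4.4] -/
theorem measurable_weightIntegrand {Λ : Set (EuclideanSpace ℝ (Fin 2))} (hΛ : MeasurableSet Λ)
    {A : Set (PointConfig (EuclideanSpace ℝ (Fin 2)))} (hA : MeasurableSet A) (k : ℕ) :
    Measurable fun p : (Fin k → EuclideanSpace ℝ (Fin 2)) ×
      PointConfig (EuclideanSpace ℝ (Fin 2)) =>
        (A ∩ {X | HardCoreIn Λ X}).indicator
          (1 : PointConfig (EuclideanSpace ℝ (Fin 2)) → ℝ≥0∞) (superpose Λ p.1 p.2) :=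
  (measurable_one.indicator (hA.inter (measurableSet_hardCoreIn hΛ))).comp
    (measurable_superpose hΛ k)

/-- For a fixed boundary condition the integrand of `weight z Λ Y A` is measurable in the thrown
points. [cite: Richthammer2007, §3.6] -/
theorem measurable_weightIntegrand_left {Λ : Set (EuclideanSpace ℝ (Fin 2))}
    (hΛ : MeasurableSet Λ) {A : Set (PointConfig (EuclideanSpace ℝ (Fin 2)))}
    (hA : MeasurableSet A) (k : ℕ) (Y : PointConfig (EuclideanSpace ℝ (Fin 2))) :
    Measurable fun x : Fin k → EuclideanSpace ℝ (Fin 2) =>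
      (A ∩ {X | HardCoreIn Λ X}).indicator
        (1 : PointConfig (EuclideanSpace ℝ (Fin 2)) → ℝ≥0∞) (superpose Λ x Y) :=
  (measurable_weightIntegrand hΛ hA k).comp (measurable_id.prodMk measurable_const)

/-- **The finite-volume weight depends measurably on the boundary condition**:
`X̄ ↦ weight z Λ X̄ A` is measurable for measurable `Λ` and `A` (measurability part of Fubini,
term by term in `k`). [cite: Richthammer2007, §3.3 (p. 7) and §3.6] -/
theorem measurable_weight (z : ℝ) {Λ : Set (EuclideanSpace ℝ (Fin 2))} (hΛ : MeasurableSet Λ)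
    {A : Set (PointConfig (EuclideanSpace ℝ (Fin 2)))} (hA : MeasurableSet A) :
    Measurable fun Y => weight z Λ Y A := by
  unfold weight
  refine Measurable.tsum fun k => Measurable.const_mul ?_ _
  exact (measurable_weightIntegrand hΛ hA k).lintegral_prod_left'

/-- **The conditional Gibbs distribution is a measurable kernel in the boundary condition**:
`X̄ ↦ γ_Λ(A | X̄)` is measurable for measurable `Λ` and `A` ("`γ_Λ` is a probability kernel
from `(𝒳𝒳, 𝓕_{𝒳𝒳,Λᶜ})` to `(𝒳, 𝓕_𝒳)`"). [cite: Richthammer2007, §3.3 (p. 7)] -/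
theorem measurable_gibbsKernel (z : ℝ) {Λ : Set (EuclideanSpace ℝ (Fin 2))}
    (hΛ : MeasurableSet Λ) {A : Set (PointConfig (EuclideanSpace ℝ (Fin 2)))}
    (hA : MeasurableSet A) :
    Measurable fun Y => gibbsKernel z Λ Y A := by
  unfold gibbsKernel
  exact (measurable_weight z hΛ hA).div (measurable_weight z hΛ MeasurableSet.univ)

/-! ### Companion lemmas (restored from the parallel file of provefact `Richthammer2007_lemma5`)

The following six declarations were landed under this module name by the parallel provefact unit
for `Richthammer2007_lemma5` (p18788) seconds before this file replaced it (p18791); they are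
restored here with the same names and statements so that both programmes can build on this
module. -/

/-- In coordinates-free form: the hard core in `Λ` holds iff every point of `X` in `Λ` is at
distance `> 1` from every other point of `X`. [cite: Richthammer2007, §3.3 (pp. 6–7)] -/
theorem hardCoreIn_iff_forall (Λ : Set (EuclideanSpace ℝ (Fin 2)))
    (X : PointConfig (EuclideanSpace ℝ (Fin 2))) :
    HardCoreIn Λ X ↔ ∀ p ∈ X, p ∈ Λ → ∀ q ∈ X, q ≠ p → 1 < dist p q := by
  constructor
  · exact fun h p hp hpΛ q hq hqp => h p hp q hq (Ne.symm hqp) (Or.inl hpΛ)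
  · intro h p hp q hq hpq hΛ
    rcases hΛ with hpΛ | hqΛ
    · exact h p hp hpΛ q hq (Ne.symm hpq)
    · rw [dist_comm]; exact h q hq hqΛ p hp hpq

/-- The hard core in `Λ` as a void event: no point `p ∈ X ∩ Λ` has occupation number
`N_{B̄(p,1)}(X) ≥ 2`. [cite: Richthammer2007, §3.3 (pp. 6–7) and §4.4 (p. 10)] -/
theorem hardCoreIn_iff_count_eq_zero (Λ : Set (EuclideanSpace ℝ (Fin 2)))
    (X : PointConfig (EuclideanSpace ℝ (Fin 2))) :
    HardCoreIn Λ X ↔ X.count {p | p ∈ Λ ∧ 2 ≤ X.toMeasure (Metric.closedBall p 1)} = 0 := by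
  rw [PointConfig.count, Set.encard_eq_zero, Set.eq_empty_iff_forall_notMem, ← not_iff_not,
    not_hardCoreIn_iff]
  push Not
  have hball : ∀ p : EuclideanSpace ℝ (Fin 2),
      X.toMeasure (Metric.closedBall p 1) = X.count {q | dist p q ≤ 1} := fun p => by
    rw [PointConfig.toMeasure_apply _ Metric.isClosed_closedBall.measurableSet]
    have hb : Metric.closedBall p 1 = {q : EuclideanSpace ℝ (Fin 2) | dist p q ≤ 1} := by
      ext q
      simp [Metric.mem_closedBall, dist_comm]
    rw [hb]
  constructor
  · rintro ⟨p, hp, hpΛ, q, hq, hqp, hd⟩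
    refine ⟨p, hp, hpΛ, ?_⟩
    rw [hball]
    exact_mod_cast (two_le_count_iff X _).2 ⟨p, hp, q, hq, by simp, hd, hqp.symm⟩
  · rintro ⟨p, ⟨hp, hpΛ, h2⟩⟩
    rw [hball] at h2
    have h2' : 2 ≤ X.count {q | dist p q ≤ 1} := by exact_mod_cast h2
    obtain ⟨a, ha, b, hb, had, hbd, hab⟩ := (two_le_count_iff X _).1 h2'
    simp only [mem_setOf_eq] at had hbd
    by_cases hap : a = p
    · subst hap
      exact ⟨a, hp, hpΛ, b, hb, Ne.symm hab, hbd⟩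
    · exact ⟨p, hp, hpΛ, a, ha, hap, had⟩

/-- The counting variables of `{x₁, …, x_k}` are measurable in `x`. [folklore] -/
theorem measurable_count_ofFn {k : ℕ} {t : Set (EuclideanSpace ℝ (Fin 2))} (ht : MeasurableSet t) :
    Measurable fun x : Fin k → EuclideanSpace ℝ (Fin 2) => (PointConfig.ofFn x).count t :=
  (PointConfig.measurable_count ht).comp (measurable_ofFn k)

/-- The superposition only sees the boundary condition outside `Λ`.
[cite: Richthammer2007, §3.2 (p. 6)] -/
theorem superpose_restrict_compl (Λ : Set (EuclideanSpace ℝ (Fin 2))) {k : ℕ}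
    (x : Fin k → EuclideanSpace ℝ (Fin 2)) (Y : PointConfig (EuclideanSpace ℝ (Fin 2))) :
    superpose Λ x (Y.restrict Λᶜ) = superpose Λ x Y := by
  ext p
  simp only [mem_superpose]
  change (p ∈ Set.range x ∧ p ∈ Λ ∨ p ∈ (Y.restrict Λᶜ).carrier ∧ p ∉ Λ) ↔
    (p ∈ Set.range x ∧ p ∈ Λ ∨ p ∈ Y.carrier ∧ p ∉ Λ)
  simp only [PointConfig.carrier_restrict, mem_inter_iff, mem_compl_iff]
  tauto

/-- Outside `Λ` the superposition is the boundary condition: `(X_Λ X̄_{Λᶜ})_{Λᶜ} = X̄_{Λᶜ}`.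
[cite: Richthammer2007, §3.2 (p. 6)] -/
theorem restrict_compl_superpose (Λ : Set (EuclideanSpace ℝ (Fin 2))) {k : ℕ}
    (x : Fin k → EuclideanSpace ℝ (Fin 2)) (Y : PointConfig (EuclideanSpace ℝ (Fin 2))) :
    (superpose Λ x Y).restrict Λᶜ = Y.restrict Λᶜ := by
  ext p
  change p ∈ (superpose Λ x Y).carrier ∩ Λᶜ ↔ p ∈ Y.carrier ∩ Λᶜ
  simp only [mem_inter_iff, mem_compl_iff]
  change ((p ∈ Set.range x ∧ p ∈ Λ ∨ p ∈ (Y : Set (EuclideanSpace ℝ (Fin 2))) ∧ p ∉ Λ) ∧ p ∉ Λ) ↔ _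
  simp only [PointConfig.coe_eq_carrier]
  tauto

end Literature.Barriers.AtomisticToContinuum.HardDisk

namespace Literature.Analysis.FunctionSpaces.PointConfig

/-- Membership in a restricted configuration (dot-notation extension of the tree's
`PointConfig.restrict`, restored from p18788). [folklore] -/
theorem mem_restrict_iff {E : Type*} [TopologicalSpace E] {s : Set E} {c : PointConfig E} {x : E} :
    x ∈ c.restrict s ↔ x ∈ c ∧ x ∈ s :=
  Iff.rfl

end Literature.Analysis.FunctionSpaces.PointConfig

end
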